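import Summits.BirchSwinnertonDyer.BirchSwinnertonDyer.Theorems.ErratumRoadFiveEulerHalfUBLinks
import Summits.BirchSwinnertonDyer.BirchSwinnertonDyer.Theorems.ErratumRoadFiveRest3TorsionBranchB
import Summits.BirchSwinnertonDyer.BirchSwinnertonDyer.Theorems.ErratumRoadFiveControlFromJSWMult
import Summits.BirchSwinnertonDyer.Rank1Residual.X11b.BDPRouteEndState
import Summits.BirchSwinnertonDyer.Rank1Residual.X11b.BDPRouteNoRam
import HarnessLib

/-!
# Route `ErratumRoadFive` (K2, `p ≥ 5`), crux `EulerHalfNotRamNoInertSetAtFive` (item stmt-BirchSwinnertonDyer-19715;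
# also the aside 19062 `EulerHalfOffLocus`): the EULER-SYSTEM HALF `Typed.MissingUpperBoundAt W p` on class X11b
# from UB∃♭ᴮ — the Euler-system inclusion «`(L_𝔭) ⊆ Ch_Λ(X_ac 𝔭bar)·Λ`» of the BDP main conjecture for `E` ITSELF
# at `p ∥ N`, at SOME frame carrying the value at `𝟙` — composed with the JSW control identity and the ℚ-descent

Cell `bsd-stepL` (run/shared/lean/pub/bsd-stepL/), seat `bsd-stepL-bdp` (prover g19, 2026-08-27).
`--supports stmt-BirchSwinnertonDyer-19715`. THEOREMS ONLY; THESES-FREE (so that a planner may cite the class-level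
theorems inside a skeleton or `closes`). Companion of `Theorems/ErratumRoadFiveEulerHalfUBLinks.lean` (the algebra and
the ℚ-descent). Memo: HOME/proof/PROOF-BDP.md §43 (g18) and §45 (this session).

## The typed input UB∃♭ᴮ (inline; no definition is introduced)

At every classical Heegner datum of route p2 (binders VERBATIM those of the cell's oriented atoms
`P2.IMCDivSomeFrameOnTreeB` ∕ `P2.IMCDivIntFrameOnTreeB`, `Theorems/ErratumRoadFiveIMCDivClassicalAtomsB.lean`), for every
anticyclotomic `(κ, γ)`, embedding datum `ι'`, infinite place `w₀`, point `P'` read as the Heegner point through `w₀`,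
and embedding `e` inducing the frame's prime `𝔭_{ι'}`: THERE IS an integral frame `(Ω_K ≠ 0, ‖Ω_p‖ = 1,
Q ∈ 𝓞_{ℂ_p}⟦T⟧)` with Castella's interpolation property at `(ι', 𝔭_{ι'})` (`R1.IsBDPLFunctionInt`), the value
`Q(𝟙) = u·((1 − a_p p⁻¹)·log_{ω_E} P')²`, `‖u‖ = 1` (`R1.BDPValueAtOneIntAt`, PUB shape — a THEOREM on every X11b pair
from Castella JIMJ 17 (2018) Thms. 2.10–2.11, bdp g12 `bdpValueSomeFrameOnTree_of_hsieh2014_of_pNew`), and, for EVERY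
prime `𝔭bar ∋ p` with `𝔭bar ≠ 𝔭_{ι'}`, the EULER-SYSTEM INCLUSION `(Q) ⊆ Ch_Λ(X_ac^∅(E/K_∞)_{𝔭bar})·𝓞_{ℂ_p}⟦T⟧` —
i.e. H∃♭ᴮ `P2.IMCDivIntFrameOnTreeB W p` with its LAST conjunct REVERSED. Orientation = the cell's family B (X-slot
at the conjugate prime; ORIENT-AUDIT-19270 form (a), referee PASS): the X-slot is where the control theorem and the
logarithm of the index live, the frame's prime is where the value is read, and rank-one log symmetry identifies the two.

## What this file proves

* §1 `EulerHalfUB.shaIndexBoundSharp_of_ubB_at_datum` — AT ONE classical datum `(N, K, Dt, H, ι, P)` of an X11b pair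
  with `p ≥ 5` and `ρ̄_{E,p}` onto: UB∃♭ᴮ at the pair + the PUBLISHED control fact
  `JetchevSkinnerWan2017.thm331_anticyclotomicControl_mult` (`h331`, via imc-t1's `controlOnTreeAt_of_thm331Mult_embAt`)
  + Kolyvagin (`hKo`: `rank_ℤ E(K) = 1` — whence the rank-one log symmetry — and `#Ш(E/K) < ∞`) ⟹
  `ord_p #Ш(E/K) + 2·ord_p ∏_ℓ c_ℓ(E) ≤ 2·ord_p [E(K):ℤP]`. Plumbing = the B-template
  `Rest3TorsionBranchB.openInputOnTreeAt_of_imcDivIntFrameB_of_controlUpper` read upward: Steinitz `ι₀`, frame prime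
  `𝔮 = 𝔭_{ι₀}`, X-slot the OTHER degree-one prime `𝔭₁` (`Three.exists_ne_degreeOne_prime`), control at `(𝔭₁, embAt 𝔭₁)`,
  value at `(𝔮, embAt 𝔮, P' = τ_* P)`, `log_{𝔮} P' ↦ log_{𝔮} P ↦ log_{𝔭₁} P` by `R1.padicLogOrd_map_eq_of_rank_one` and
  door-c5's `exists_algEquiv_embAt_eq_comp`.
* §2 `EulerHalfUB.missingUpperBoundAt_of_classX11b_of_ram_of_ubB` — on X11b ∧ `p ≥ 5` ∧ (ram): UB∃♭ᴮ at the pair +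
  PUBLISHED facts (`h331`, Gross–Zagier, Kolyvagin, Skinner 2016 Thm. C for the twist, GZK, modularity ×2,
  Hoffstein–Luo, Mazur 1978 Cor. 4.1) ⟹ `Typed.MissingUpperBoundAt W p` — NO Tamagawa condition, NO Shimura curve,
  NO inert set: on the (ram) ∧ `p ∣ ∏c` atom (incl. (T2α) split-deep, where the classical Kolyvagin road loses
  `2·ord_p c_p`) this is a SECOND road next to shim-p1's inert Shimura line.
* (companion `Theorems/ErratumRoadFiveEulerHalfFromUBNotRam.lean`, split for the 400-line rule) §3 the ¬(ram) ∧ surj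
  twin with the route's crux `X11aLowerHalf` for the twist, and §4 the BODY of item 19715 verbatim; the by-name wrapper
  (importing the route file) is `Theorems/ErratumRoadFiveEulerHalfNotRamNoInertSetOfUB.lean`.

HONEST FRAMING: implications only. UB∃♭ᴮ is OPEN in print at every `p ∣ N` (lit g19 EPS3-SOURCES §E.1: «not in print
at any p ∣ N»); the cell holds the underlying divisibility «`L_𝔭 ∈ Ch_Λ(X_ac 𝔭bar)·Λ_{R₀}`» at MEMO grade (PROOF-BDP
§38.8/§38.10/§39 non-split — referee PASS on §38/38.8/38.9, §39 owed — and §41 split, grants G1–G3 owed), class-wide on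
X11b ∧ `p ≥ 5` ∧ surj with strict-Heegner `K`, `p ∤ h_K`, `D_K ∉ {−3,−4}`. `X11aLowerHalf` is an OPEN crux (rung K6's
object). Nothing is discharged, booked or re-labelled (T7); BSD is proved for no pair; item 19715 is NOT closed.

References: [Castella2018] Thms. 2.3, 3.1, 3.2, §5 (arXiv:1704.06608 pp. 5, 9, 12); [Castella2018Exceptional] Thms.
2.10–2.11 (arXiv:1507.04260 pp. 13–14); [JetchevSkinnerWan2017] Thm. 3.3.1, §7.4.1–7.4.2 (arXiv:1512.06894 pp. 11,
30–31); [Skinner2016PacificMC] Thm. C; [HoffsteinLuo1997]; [Mazur1978] Cor. 4.1; [Miller2011LMS] Def. 1.1; cell audit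
ORIENT-AUDIT-19270 form (a).
-/

set_option autoImplicit false
set_option linter.dupNamespace false

noncomputable section

open scoped Classical NumberField

open WeierstrassCurve NumberField IsDedekindDomain Field PowerSeries
open Literature.NumberTheory.EllipticCurves Literature.NumberTheory.EllipticCurves.GreenbergSelmer
open Literature.NumberTheory.EllipticCurves.ModularForms
open Literature.NumberTheory.EllipticCurves.Rank1Residual
open Literature.NumberTheory.EllipticCurves.Rank1Residual.Typed
open Literature.NumberTheory.EllipticCurves.JetchevSkinnerWan2017
open Literature.NumberTheory.EllipticCurves.Skinner2016
open Literature.NumberTheory.GaloisRepresentations Literature.NumberTheory.GaloisCohomology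
open Literature.NumberTheory.Automorphic
open Summit.BirchSwinnertonDyer.Rank1Residual Summit.BirchSwinnertonDyer.Rank1Residual.X11b
open Summit.BirchSwinnertonDyer.Rank1Residual.X11b.AcSelmer
open Summit.BirchSwinnertonDyer.Rank1Residual.X11b.Halves
open Summit.BirchSwinnertonDyer.BirchSwinnertonDyer.Theorems.SchneiderFreeAdditiveX3

namespace Summit.BirchSwinnertonDyer.BirchSwinnertonDyer.Theorems.EulerHalfUB

/-! ### §1 AT ONE DATUM: UB∃♭ᴮ + the JSW control fact ⟹ the sharp upper bound over `K` -/

section Datum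

variable {W : WeierstrassCurve ℚ} [W.IsElliptic] [W.IsGloballyMinimal] {p : ℕ} [Fact p.Prime]

/-- **The SHARP upper bound `ord_p #Ш(E/K) + 2·ord_p ∏_ℓ c_ℓ(E) ≤ 2·ord_p [E(K):ℤP]` at ONE classical datum of
an X11b pair (`p ≥ 5`, `ρ̄_{E,p}` onto) from UB∃♭ᴮ at the pair and PUBLISHED facts** (`h331` = JSW17 Thm. 3.3.1 at a
multiplicative `p`, `hKo` = Kolyvagin: rank one — for the log symmetry — and finiteness). At the datum: Steinitz `ι₀`, the unique
infinite place `w₀`, `τ ∈ Gal(K/ℚ)` with `ι = w₀ ∘ τ` and `P' = τ_* P` (the Heegner point read through `w₀`); frame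
prime `𝔮 = 𝔭_{ι₀}` (degree one since `p ∣ N` splits), X-slot `𝔭₁ ≠ 𝔮` the other prime above `p`; UB∃♭ᴮ gives
`(Ω_K, Ω_p, Q)` with `Q(𝟙) = u·((1 − a_p/p)·log_𝔮 P')²` and `(Q) ⊆ Ch_Λ(X_ac 𝔭₁)·𝓞_{ℂ_p}⟦T⟧`; the control identity at
`(𝔭₁, embAt 𝔭₁, P)` (`controlOnTreeAt_of_thm331Mult_embAt`: `E[p]` irreducible over `G_K` from surjectivity,
`irrK_of_surj`; `p` split; rank one and finiteness from `hKo`); `ord_p f_ac(0) ≤ 2·(ord_p log_𝔮 P' − 1)`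
(`charValuation_le_of_span_le_of_intValue`, `p ∤ a_p` at multiplicative `p`); `log_𝔮 P' = log_𝔮 P = log_{𝔭₁} P` in
`ord_p` (rank one); then `shaIndexBoundSharp_of_heegner`. CONDITIONAL on UB∃♭ᴮ; nothing booked.
[cite: JetchevSkinnerWan2017, Thm. 3.3.1 with §3.5 (3.5.c) and §7.4.2 (arXiv:1512.06894 pp. 11, 15, 31)]
[cite: Castella2018, Thms. 2.3, 3.1, 3.2 and §5 (5.2) (arXiv:1704.06608 pp. 5, 9, 12)]
[cite: CastellaGrossiLeeSkinner2022, Thm. 5.1.1 (the prime of the logarithm)] [cite: Kolyvagin1990, Thm. A] -/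
theorem shaIndexBoundSharp_of_ubB_at_datum
    (h331 : thm331_anticyclotomicControl_mult)
    (hKo : ∀ (N : ℕ) [NeZero N] (W : WeierstrassCurve ℚ) (K : Type) [Field K] [NumberField K],
      kolyvagin N W K)
    -- UB∃♭ᴮ at the pair `(W, p)`: H∃♭ᴮ with the divisibility conjunct REVERSED (the Euler-system inclusion)
    (hUB : ∀ (N : ℕ) [NeZero N] (K : Type) [Field K] [NumberField K]
      (Dt : ModularParametrizationData W N) (H : HeegnerDatum N (NumberField.discr K)) (ι : K →+* ℂ)
      (P : (W.baseChange K).toAffine.Point),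
      ClassX11b W p → 5 ≤ p → Surj W p → W.conductorNorm ℤ = N → IsImaginaryQuadratic K →
      Odd (NumberField.discr K) → ¬ (p : ℤ) ∣ NumberField.discr K → ¬ p ∣ Units.torsionOrder K →
      SatisfiesHeegnerHypothesis N K →
      (W.quadraticTwist (NumberField.discr K : ℚ)).entireLFunction 1 ≠ 0 →
      WeierstrassCurve.Affine.Point.map ι.toRatAlgHom P = heegnerPointComplex Dt H →
      ¬ (p : ℤ) ∣ Dt.c → ¬ IsOfFinAddOrder P →
      ∀ (κ : ZpExtension K p), κ.IsAnticyclotomic →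
        ∀ (γ : Field.absoluteGaloisGroup K) [Fact (κ.IsTopGenerator γ)]
          (ι' : PadicAlgCl p ≃+* ℂ) (w₀ : InfinitePlace K) (P' : (W.baseChange K).toAffine.Point),
          WeierstrassCurve.Affine.Point.map w₀.embedding.toRatAlgHom P' = heegnerPointComplex Dt H →
          ∀ (e : K →+* ℚ_[p]),
            (∀ k : 𝓞 K, k ∈ (primeOfEmbeddingDatum p ι' w₀.embedding).asIdeal ↔ ‖e (k : K)‖ < 1) →
            ∃ (ΩK : ℂ) (Ωp : ℂ_[p]) (Q : PowerSeries 𝓞_ℂ_[p]), ΩK ≠ 0 ∧ ‖Ωp‖ = 1 ∧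
              R1.IsBDPLFunctionInt p ι' (primeOfEmbeddingDatum p ι' w₀.embedding) κ γ Dt.f ΩK Ωp Q ∧
              R1.BDPValueAtOneIntAt W p e P' Q (W.LFunction p) ∧
              ∀ (𝔭bar : HeightOneSpectrum (𝓞 K)), ((p : ℕ) : 𝓞 K) ∈ 𝔭bar.asIdeal →
                𝔭bar ≠ primeOfEmbeddingDatum p ι' w₀.embedding →
                Ideal.span {Q} ≤
                  (XAc.charIdeal (W.baseChange K) p κ 𝔭bar ∅ γ).map (PowerSeries.map (R1.toCpInt p)))
    -- the datum
    (N : ℕ) [NeZero N] (K : Type) [Field K] [NumberField K]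
    (Dt : ModularParametrizationData W N) (H : HeegnerDatum N (NumberField.discr K)) (ιK : K →+* ℂ)
    (P : (W.baseChange K).toAffine.Point)
    (hX : ClassX11b W p) (hp5 : 5 ≤ p) (hsurj : Surj W p) (hN : W.conductorNorm ℤ = N)
    (hK : IsImaginaryQuadratic K) (hodd : Odd (NumberField.discr K)) (hpd : ¬ (p : ℤ) ∣ NumberField.discr K)
    (hμ : ¬ p ∣ Units.torsionOrder K) (hHN : SatisfiesHeegnerHypothesis N K)
    (hLt : (W.quadraticTwist (NumberField.discr K : ℚ)).entireLFunction 1 ≠ 0)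
    (hP : WeierstrassCurve.Affine.Point.map ιK.toRatAlgHom P = heegnerPointComplex Dt H)
    (hc : ¬ (p : ℤ) ∣ Dt.c) (hPinf : ¬ IsOfFinAddOrder P) :
    padicValNat p (W.baseChange K).shaOrder + 2 * padicValNat p W.tamagawaProduct ≤
      2 * padicValNat p (AddSubgroup.zmultiples P).index := by
  have hX' := hX
  obtain ⟨hr, -, hmult, -⟩ := hX
  have hp : p.Prime := Fact.out
  have hp2 : p ≠ 2 := by omega
  have hp3 : 3 ≤ p := le_trans (by norm_num) hp5
  obtain ⟨w₀⟩ := (inferInstance : Nonempty (InfinitePlace K))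
  -- Kolyvagin: `rank_ℤ E(K) = 1`, `#Ш(E/K) < ∞`
  obtain ⟨hrk, hfinK⟩ := hKo N W K hK hHN ⟨Dt, H, ιK, hP⟩ hPinf
  haveI : Finite (W.baseChange K).sha := hfinK
  have hfin : Finite (AddCommGroup.primaryComponent (W.baseChange K).sha p) := inferInstance
  -- `p ∣ N` splits in `K`
  have hpN : p ∣ N := hN ▸ dvd_conductorNorm_of_mult hmult
  have hHp : SatisfiesHeegnerHypothesis p K := SatisfiesHeegnerHypothesis.of_dvd hpN hHN
  have hsplit : SplitsIn K p := hHN p hp hpN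
  have hirrK : (W.baseChange K).HasIrreducibleModPGaloisRep p := irrK_of_surj W p hsurj K hK.1
  -- the datum's complex embedding is `w₀.embedding ∘ τ` for some `τ ∈ Gal(K/ℚ)`, `τ² = 1`
  haveI : IsGalois ℚ K := by
    haveI : Algebra.IsQuadraticExtension ℚ K := ⟨hK.1⟩
    infer_instance
  obtain ⟨σ, hσ⟩ := ComplexEmbedding.exists_comp_symm_eq_of_comp_eq (k := ℚ) w₀.embedding ιK
    (by ext x; simp)
  set τ : K →+* K := ((σ.symm : K ≃ₐ[ℚ] K) : K →+* K) with hτdef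
  have hτ : ∀ x, τ (τ x) = x := by
    intro x
    have hcard : Nat.card (K ≃ₐ[ℚ] K) = 2 := by rw [IsGalois.card_aut_eq_finrank, hK.1]
    have hsq : σ.symm * σ.symm = 1 := by
      have h := pow_card_eq_one' (G := K ≃ₐ[ℚ] K) (x := σ.symm)
      rwa [hcard, pow_two] at h
    have := congrArg (fun g : K ≃ₐ[ℚ] K ↦ g x) hsq
    simpa [hτdef, AlgEquiv.mul_apply] using this
  -- the Galois conjugate `P' = τ_* P` is the Heegner point read through `w₀.embedding`; it has infinite order
  set P' := WeierstrassCurve.Affine.Point.map τ.toRatAlgHom P with hP'def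
  have hP' : WeierstrassCurve.Affine.Point.map w₀.embedding.toRatAlgHom P' =
      heegnerPointComplex Dt H := by
    rw [hP'def, WeierstrassCurve.Affine.Point.map_map]
    have hcomp : w₀.embedding.toRatAlgHom.comp τ.toRatAlgHom = ιK.toRatAlgHom := by
      apply AlgHom.ext
      intro x
      have := RingHom.congr_fun hσ x
      simpa [hτdef] using this
    rw [hcomp]
    exact hP
  have hPinf' : ¬ IsOfFinAddOrder P' := fun h ↦
    hPinf ((WeierstrassCurve.Affine.Point.map_injective (f := τ.toRatAlgHom)).isOfFinAddOrder_iff.mp h)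
  have hlog : ∀ e : K →+* ℚ_[p], X11b.padicLogOrd W p e P' = X11b.padicLogOrd W p e P := fun e ↦
    R1.padicLogOrd_map_eq_of_rank_one W p e P hp2 τ hτ hrk hPinf
  -- Steinitz; the frame prime `𝔮 = 𝔭_{ι₀}` (degree one) and THE embedding at `𝔮`
  obtain ⟨ι₀⟩ := PadicAlgCl.nonempty_ringEquiv_complex p
  have h𝔮 : ((p : ℕ) : 𝓞 K) ∈ (primeOfEmbeddingDatum p ι₀ w₀.embedding).asIdeal :=
    natCast_mem_primeOfEmbeddingDatum p ι₀ w₀.embedding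
  obtain ⟨he𝔮, hf𝔮⟩ := degreeOne_primeOfEmbeddingDatum p ι₀ hK.1 hsplit w₀.embedding
  have hemb𝔮 : ∀ k : 𝓞 K, k ∈ (primeOfEmbeddingDatum p ι₀ w₀.embedding).asIdeal ↔
      ‖embAt K p _ h𝔮 he𝔮 hf𝔮 (k : K)‖ < 1 :=
    mem_asIdeal_iff_norm_embAt_lt_one _ h𝔮 he𝔮 hf𝔮
  -- anticyclotomic `(κ, γ)`
  obtain ⟨κ, γ, _𝔭₀, hκ, hγ, -⟩ := exists_anticyclotomic_generator_prime (p := p) hK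
  haveI : Fact (κ.IsTopGenerator γ) := ⟨hγ⟩
  -- UB∃♭ᴮ at the frame `(ι₀, 𝔮)`, value through `embAt 𝔮` at `P'`
  obtain ⟨ΩK, Ωp, Q, -, -, -, ⟨u, hu1, hu⟩, hUBall⟩ :=
    hUB N K Dt H ιK P hX' hp5 hsurj hN hK hodd hpd hμ hHN hLt hP hc hPinf κ hκ γ ι₀ w₀ P' hP'
      (embAt K p _ h𝔮 he𝔮 hf𝔮) hemb𝔮
  -- the OTHER degree-one prime `𝔭₁` above `p`: the X-slot
  obtain ⟨𝔭₁, hne, h𝔭₁, he₁, hf₁⟩ := Three.exists_ne_degreeOne_prime hK.1 (p := p) h𝔮 he𝔮 hf𝔮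
  have hUB₁ := hUBall 𝔭₁ h𝔭₁ hne
  -- the control IDENTITY at `(𝔭₁, embAt 𝔭₁, P)` from the JSW fact
  have hCTL : ControlOnTreeAt p κ 𝔭₁ γ (embAt K p 𝔭₁ h𝔭₁ he₁ hf₁) P :=
    controlOnTreeAt_of_thm331Mult_embAt h331 hp3 hmult hK hHp hirrK κ hκ γ 𝔭₁ h𝔭₁ he₁ hf₁ hrk hfin P hPinf
  obtain ⟨n, hn, -⟩ := id hCTL
  -- UB ∘ value at `𝟙`: `ord_p f_ac(0) ≤ 2·(ord_p log_𝔮 P' − 1)`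
  have ha : ¬ (p : ℤ) ∣ W.LFunction p := R1.not_dvd_lFunction_of_mult Dt.isNewformOf hmult
  have hle₀ : (n : ℤ) ≤ 2 * (X11b.padicLogOrd W p (embAt K p _ h𝔮 he𝔮 hf𝔮) P' - 1) :=
    charValuation_le_of_span_le_of_intValue hn hUB₁ hu1 ha hPinf' hu
  -- rank-one log symmetry: `log_𝔮 P' ↦ log_𝔮 P ↦ log_{𝔭₁} P`
  have hsymm : X11b.padicLogOrd W p (embAt K p 𝔭₁ h𝔭₁ he₁ hf₁) P =
      X11b.padicLogOrd W p (embAt K p _ h𝔮 he𝔮 hf𝔮) P := by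
    obtain ⟨ρ, -, hρρ, happ⟩ := exists_algEquiv_embAt_eq_comp (p := p) hK.1 h𝔮 he𝔮 hf𝔮 h𝔭₁ he₁ hf₁ hne
    have hcompρ : (embAt K p _ h𝔮 he𝔮 hf𝔮).comp (ρ : K →+* K) = embAt K p 𝔭₁ h𝔭₁ he₁ hf₁ :=
      RingHom.ext fun x => (happ x).symm
    rw [← hcompρ, ← R1.padicLogOrd_map_eq_comp]
    exact R1.padicLogOrd_map_eq_of_rank_one W p _ P hp2 (ρ : K →+* K) (fun x => hρρ x) hrk hPinf
  have hle : (n : ℤ) ≤ 2 * (X11b.padicLogOrd W p (embAt K p 𝔭₁ h𝔭₁ he₁ hf₁) P - 1) := by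
    rw [hsymm, ← hlog]
    exact hle₀
  exact shaIndexBoundSharp_of_heegner hp5 hK hN hHN hn hle hCTL

end Datum

/-! ### §2 Class X11b ∧ (ram): the Euler-system half from UB∃♭ᴮ + published facts (twist: Skinner 2016 Thm. C) -/

section Ram

/-- **The Euler-system half `Typed.MissingUpperBoundAt W p` on X11b ∧ `p ≥ 5` ∧ (ram) from UB∃♭ᴮ at the pair and
PUBLISHED facts — NO Tamagawa condition, NO Shimura curve.** The odd-`d_K` Manin-good Heegner datum of the pair
(`exists_oddHeegnerData`: Hoffstein–Luo field, Mazur 1978 Cor. 4.1, Néron scaling a theorem); `ρ̄_{E,p}` onto from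
(irr) + (ram) (`surj_of_irr_of_ram`); the sharp bound over `K` (§1); the twist `E^{d_K}` on its minimal model is
multiplicative ∧ irreducible ∧ (ram) at `p` with `L(E^{d_K},1) ≠ 0`, so Skinner 2016 Thm. C (`hSk`) gives the `≥`-half of
its `p`-part; the ℚ-descent `missingUpperBoundAt_of_shaIndexBoundSharp_of_odd`. On (ram) ∧ `p ∤ ∏c` this re-proves the
tree's `missingUpperBoundAt_of_classX11b_of_ram_of_not_dvd` (Kolyvagin) from UB instead; on (ram) ∧ `p ∣ ∏c` (incl. the
(T2α) split-deep pairs, where Kolyvagin over the classical curve loses `2·ord_p c_p`) it is a SECOND road next to the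
inert Shimura line (`eulerSplitDeepRam_of_published`). CONDITIONAL on UB∃♭ᴮ; nothing booked.
[cite: JetchevSkinnerWan2017, Thm. 3.3.1 and §7.4.2 (arXiv:1512.06894 pp. 11, 31)]
[cite: Skinner2016PacificMC, Thm. C (§1) and footnote 1] [cite: HoffsteinLuo1997, Theorem (§1)]
[cite: Mazur1978, Cor. 4.1] [cite: Castella2018, Thms. 2.3, 3.1, 3.2 (arXiv:1704.06608 pp. 5, 9)]
[cite: Miller2011LMS, Def. 1.1 (arXiv:1010.2431 p. 3)] -/
theorem missingUpperBoundAt_of_classX11b_of_ram_of_ubB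
    (h331 : thm331_anticyclotomicControl_mult)
    (hGZ : ∀ (N : ℕ) [NeZero N] (W : WeierstrassCurve ℚ) (K : Type) [Field K] [NumberField K],
      gross_zagier N W K)
    (hKo : ∀ (N : ℕ) [NeZero N] (W : WeierstrassCurve ℚ) (K : Type) [Field K] [NumberField K],
      kolyvagin N W K)
    (hSk : Skinner2016.thmC_padicValRat_bsd_rank_zero)
    (hGZK : rank_eq_analyticRank_of_analyticRank_le_one) (hmod : hasEntireLFunction_rat)
    (hnf : exists_isNewformOf) (hHL : HoffsteinLuo1997_exists_twist_L_one_ne_zero)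
    (hMaz : mazur_not_dvd_maninConstant_of_odd)
    (W : WeierstrassCurve ℚ) [W.IsElliptic] [W.IsGloballyMinimal] (p : ℕ) [Fact p.Prime]
    (hX : ClassX11b W p) (hp5 : 5 ≤ p) (hram : Ram W p)
    -- UB∃♭ᴮ at the pair
    (hUB : ∀ (N : ℕ) [NeZero N] (K : Type) [Field K] [NumberField K]
      (Dt : ModularParametrizationData W N) (H : HeegnerDatum N (NumberField.discr K)) (ι : K →+* ℂ)
      (P : (W.baseChange K).toAffine.Point),
      ClassX11b W p → 5 ≤ p → Surj W p → W.conductorNorm ℤ = N → IsImaginaryQuadratic K →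
      Odd (NumberField.discr K) → ¬ (p : ℤ) ∣ NumberField.discr K → ¬ p ∣ Units.torsionOrder K →
      SatisfiesHeegnerHypothesis N K →
      (W.quadraticTwist (NumberField.discr K : ℚ)).entireLFunction 1 ≠ 0 →
      WeierstrassCurve.Affine.Point.map ι.toRatAlgHom P = heegnerPointComplex Dt H →
      ¬ (p : ℤ) ∣ Dt.c → ¬ IsOfFinAddOrder P →
      ∀ (κ : ZpExtension K p), κ.IsAnticyclotomic →
        ∀ (γ : Field.absoluteGaloisGroup K) [Fact (κ.IsTopGenerator γ)]
          (ι' : PadicAlgCl p ≃+* ℂ) (w₀ : InfinitePlace K) (P' : (W.baseChange K).toAffine.Point),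
          WeierstrassCurve.Affine.Point.map w₀.embedding.toRatAlgHom P' = heegnerPointComplex Dt H →
          ∀ (e : K →+* ℚ_[p]),
            (∀ k : 𝓞 K, k ∈ (primeOfEmbeddingDatum p ι' w₀.embedding).asIdeal ↔ ‖e (k : K)‖ < 1) →
            ∃ (ΩK : ℂ) (Ωp : ℂ_[p]) (Q : PowerSeries 𝓞_ℂ_[p]), ΩK ≠ 0 ∧ ‖Ωp‖ = 1 ∧
              R1.IsBDPLFunctionInt p ι' (primeOfEmbeddingDatum p ι' w₀.embedding) κ γ Dt.f ΩK Ωp Q ∧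
              R1.BDPValueAtOneIntAt W p e P' Q (W.LFunction p) ∧
              ∀ (𝔭bar : HeightOneSpectrum (𝓞 K)), ((p : ℕ) : 𝓞 K) ∈ 𝔭bar.asIdeal →
                𝔭bar ≠ primeOfEmbeddingDatum p ι' w₀.embedding →
                Ideal.span {Q} ≤
                  (XAc.charIdeal (W.baseChange K) p κ 𝔭bar ∅ γ).map (PowerSeries.map (R1.toCpInt p))) :
    Typed.MissingUpperBoundAt W p := by
  have hNS : integral_neronScaling_of_isGloballyMinimal := integral_neronScaling_of_isGloballyMinimal_holds
  have hp : p.Prime := Fact.out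
  have hX' := hX
  obtain ⟨hr, hp2, hmult, hirr⟩ := hX
  have hp3 : 3 ≤ p := le_trans (by norm_num) hp5
  haveI : NeZero (W.conductorNorm ℤ) := ⟨(W.conductorNorm_pos_holds).ne'⟩
  obtain ⟨K, _, _, Dt, H, ι, P, Wd, _, _, Cd, hK, hodd, hpd, hHN, hP, hc, hμ, hLt, hWd⟩ :=
    exists_oddHeegnerData hnf hHL hMaz hNS W p hr hp2 hmult hirr
  have hsurj : Surj W p := surj_of_irr_of_ram W p hirr hram
  -- the twist on its minimal model: (a)–(e) transports, `L(E^D,1) ≠ 0`, finiteness, Skinner 2016 Thm. C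
  have hD0 : (NumberField.discr K : ℚ) ≠ 0 := by exact_mod_cast NumberField.discr_ne_zero K
  haveI hEt : (W.quadraticTwist (NumberField.discr K : ℚ)).IsElliptic := W.isElliptic_quadraticTwist hD0
  have hmultd : Wd.HasMultiplicativeReductionAtPrime p :=
    hasMultiplicativeReductionAtPrime_twist_of_heegner' W p K hK hHN hmult Cd hWd
  have hirrd : Wd.HasIrreducibleModPGaloisRep p :=
    hasIrreducibleModPGaloisRep_twist_model W p K hK.1 hirr Cd hWd
  have hramd : Ram Wd p := ram_twist_of_heegner W p K hK hHN hram Cd hWd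
  have hLt' : (W.quadraticTwist (NumberField.discr K : ℚ)).entireLFunction = Wd.entireLFunction := by
    rw [← hWd, entireLFunction_smul]
  have hLd1 : Wd.entireLFunction 1 ≠ 0 := by rw [← hLt']; exact hLt
  have hrd : Wd.analyticRank = 0 := (Wd.analyticRank_eq_zero_iff_holds (hmod Wd)).2 hLd1
  have hfinSd : Finite Wd.sha := (hGZK Wd (by omega)).2
  obtain ⟨qd, hqd, hvqd⟩ := hSk Wd p hp3 (Or.inr hmultd) hirrd hramd hLd1 hfinSd
  have hPinf : ¬ IsOfFinAddOrder P :=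
    not_isOfFinAddOrder_of_heegner_of_analyticRank_eq_one W _ K Dt H ι P (hGZ _ W K) hmod hr hK hHN hLt hP
  exact missingUpperBoundAt_of_shaIndexBoundSharp_of_odd W p K Dt H ι P (hGZ _ W K) (hKo _ W K) hGZK hmod
    hr hp2 hmult hK hodd hpd hHN hP hc hμ hLt Wd Cd hWd ⟨qd, hqd, hvqd.le⟩
    (fun _ _ ↦ shaIndexBoundSharp_of_ubB_at_datum h331 hKo hUB _ K Dt H ι P hX' hp5 hsurj rfl hK
      hodd hpd hμ hHN hLt hP hc hPinf)

end Ram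

end Summit.BirchSwinnertonDyer.BirchSwinnertonDyer.Theorems.EulerHalfUB

end
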